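import Summits.QuantumFields.YangMills.Theses.ParabolicTrajectory
import Literature.MathematicalPhysics.QuantumFieldTheory.BalabanBanachStep
import Summits.QuantumFields.YangMills.Theorems.ParabolicTrajectoryLatticeGapOnTrajectoryScalingDefs

/-!
# Route `ParabolicTrajectory`, crux `LatticeGapOnTrajectory` (stmt-QuantumFields-10523), line `trajectory-gap-scaling`:
# stub `stub_gapScaling`

`stub_gapScaling : GapScaling` — the covariance bookkeeping ("gap scaling") of the line.

Statement: for a realisation `S : BalabanBanachStep G r M'` with ODD block factor `M'`, unit-scale
normalisations bounded away from zero (`c₀ ≤ |S.c g σ|` on `(0, g₀]`) and a region `U` of effective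
theories clustering uniformly at rate `m` (`ClustersOn S U m`), every sequence of bare couplings `g k`
whose Wilson orbit stays in the chart for `j k` steps and then sits in `U` (eventually in `k`) has
block-clustering fine Wilson theories `BlockClustering r (betaOf ∘ g) M' j m`.

Proof: the certificate bounds `|S.expect (F^[j k] p₀) (2T+1) 2 σ ![f, τ_t f']|` at the orbit point;
iterated exact RG covariance `BalabanBanachStep.expect_iterate` rewrites this as `S.expect p₀` on the
torus of `M'^(j k)(2T+1)` sites with `j k`-fold `blockDilate`d test functions; since `M'` is odd,
`M'^(j k)(2T+1) = 2L+1` with `L = (M'^(j k)(2T+1) - 1)/2`, and the Wilson identification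
`expect_wilson` turns it into `wilsonCentredSchwinger r.ρ (betaOf (g k)) L (c (g k))`; the centred
Wilson functions are multilinear in the normalisations (`smearedLatticeField` is linear in `c`), so the
unit-normalised function is the `c`-normalised one divided by `c (σ 0) c (σ 1)`, whose absolute value
is at least `c₀ c₁`; the constant becomes `C / (c₀ c₁)`.
-/

open scoped SchwartzMap
open MeasureTheory Filter Topology
open Literature.MathematicalPhysics.QuantumFieldTheory Literature.MathematicalPhysics.QuantumLattice
open Summit.QuantumFields.YangMills.Theses.ParabolicTrajectory

noncomputable section

namespace Summit.QuantumFields.YangMills.Cruxes.LatticeGapOnTrajectory.TrajectoryGapScaling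

/-! ## Proof of the stub -/

section Helpers

-- adapted from Summits/QuantumFields/YangMills/Cruxes/LatticeGapOnTrajectory/Triage1Checks.lean
-- (`odd_block_factor_exact`)
/-- For an odd block factor `M`, the fine torus of `M^j (2T+1)` sites is an odd torus `2L+1`
with `L = (M^j (2T+1) - 1) / 2` (the side on which `expect_wilson` speaks). -/
private theorem gapScaling_odd_torus (M j T : ℕ) (hM : Odd M) :
    M ^ j * (2 * T + 1) = 2 * ((M ^ j * (2 * T + 1) - 1) / 2) + 1 := by
  have hodd : Odd (M ^ j * (2 * T + 1)) := (hM.pow).mul (odd_two_mul_add_one T)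
  obtain ⟨n, hn⟩ := hodd
  omega

/-- The smeared lattice field is linear in its multiplicative normalisation:
`Φ_{a,c}(f) = c · Φ_{a,1}(f)`. -/
private theorem gapScaling_smeared_mul {G : Type} [MeasurableSpace G] (O : LGConfig 4 G → ℝ)
    (Λ : Finset (Literature.Probability.LatticeModels.Site 4)) (a c m' : ℝ)
    (f : 𝓢(EuclideanSpace ℝ (Fin 4), ℝ)) (U : LGConfig 4 G) :
    smearedLatticeField O Λ a c m' f U = c * smearedLatticeField O Λ a 1 m' f U := by
  unfold smearedLatticeField
  ring

/-- The division step: `c₀ ≤ |a|`, `c₁ ≤ |b|` (`c₀, c₁ > 0`) and `|a b w| ≤ C e` give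
`|w| ≤ (C / (c₀ c₁)) e`. -/
private theorem gapScaling_div_bound {a b w C e c₀ c₁ : ℝ} (hc₀ : 0 < c₀) (hc₁ : 0 < c₁)
    (ha : c₀ ≤ |a|) (hb : c₁ ≤ |b|) (h : |a * b * w| ≤ C * e) :
    |w| ≤ C / (c₀ * c₁) * e := by
  rw [abs_mul, abs_mul] at h
  have h1 : c₀ * c₁ * |w| ≤ |a| * |b| * |w| :=
    mul_le_mul_of_nonneg_right (mul_le_mul ha hb hc₁.le (abs_nonneg _)) (abs_nonneg _)
  rw [div_mul_eq_mul_div, le_div_iff₀ (mul_pos hc₀ hc₁)]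
  linarith [h1.trans h]

variable {G : Type} [Group G] [TopologicalSpace G] [IsTopologicalGroup G] [CompactSpace G]
  [MeasurableSpace G] [BorelSpace G]

/-- Multilinearity of the centred Wilson `n`-point function in the normalisations:
`W_c = (∏ i, c (σ i)) · W_1`. -/
private theorem gapScaling_wilson_mul {N : ℕ} (ρ : G →* Matrix (Fin N) (Fin N) ℂ) (β : ℝ)
    (L : ℕ) (c : YMSpecies G → ℝ) (n : ℕ) (σ : Fin n → YMSpecies G)
    (f : Fin n → 𝓢(EuclideanSpace ℝ (Fin 4), ℝ)) :
    wilsonCentredSchwinger ρ β L c n σ f =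
      (∏ i, c (σ i)) * wilsonCentredSchwinger ρ β L (fun _ => 1) n σ f := by
  unfold wilsonCentredSchwinger
  rw [← integral_const_mul]
  congr 1
  funext U
  rw [← Finset.prod_mul_distrib]
  exact Finset.prod_congr rfl fun i _ => gapScaling_smeared_mul _ _ _ _ _ _ _

end Helpers

/-- **Gap scaling (stub 3 of line `trajectory-gap-scaling`).** If the effective theories cluster
at rate `m` uniformly on `U` (`ClustersOn S U m`) and, eventually in `k`, the Wilson orbit of the
bare coupling `g k` stays in the chart for `j k` steps and then sits in `U`, then the fine Wilson
theories at `betaOf (g k)` block-cluster at rate `m` per `M'^(j k)` sites with unit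
normalisations (`BlockClustering`). Proof: exact RG covariance `expect_iterate` moves the
certificate's bound from the torus `2T+1` of the effective theory to the torus `M'^(j k)(2T+1)`
of the starting Wilson point with `j k`-fold block-dilated test functions; `M'` odd makes this an
odd torus `2L+1`, where `expect_wilson` identifies `expect` with
`wilsonCentredSchwinger r.ρ (betaOf (g k)) L (c (g k))`; multilinearity in `c` and the lower
bounds `c₀ ≤ |c g (σ 0)|`, `c₁ ≤ |c g (σ 1)|` give the unit-normalised bound with constant
`C / (c₀ c₁)`. -/
theorem stub_gapScaling : GapScaling := by
  intro G _ _ _ _ _ _ r M' S U m hM' hc hclust g j hgj σ f f' hf hf'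
  obtain ⟨C, T₁, hC⟩ := hclust σ f f' hf hf'
  obtain ⟨c₀, hc₀, hc₀le⟩ := hc (σ 0)
  obtain ⟨c₁, hc₁, hc₁le⟩ := hc (σ 1)
  refine ⟨C / (c₀ * c₁), T₁, ?_⟩
  filter_upwards [hgj] with k hk T hT t ht1 htT
  obtain ⟨hg, hchart, hU⟩ := hk
  -- the in-chart history in the form consumed by `expect_iterate`
  have hp : ∀ i < j k, (S.F^[i] (g k, S.yW (g k))).1 ∈ Set.Icc 0 S.δ ∧
      ‖(S.F^[i] (g k, S.yW (g k))).2‖ ≤ S.R := fun i hi =>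
    have h := Set.mem_prod.1 (hchart i hi.le)
    ⟨h.1, mem_closedBall_zero_iff.1 h.2⟩
  -- the certificate's bound at the orbit point, transported to the fine Wilson theory
  have hb := hC _ hU T hT t ht1 htT
  rw [S.expect_iterate _ (j k) hp (2 * T + 1) 2 σ, gapScaling_odd_torus M' (j k) T hM',
    S.expect_wilson (g k) hg, gapScaling_wilson_mul, Fin.prod_univ_two] at hb
  have hvec : (fun i => (blockDilate M')^[j k] (![f, timeShiftTest 4 (t : ℝ) f'] i)) =
      ![(blockDilate M')^[j k] f, (blockDilate M')^[j k] (timeShiftTest 4 (t : ℝ) f')] := by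
    funext i
    fin_cases i <;> rfl
  rw [hvec] at hb
  exact gapScaling_div_bound hc₀ hc₁ (hc₀le _ hg) (hc₁le _ hg) hb

end Summit.QuantumFields.YangMills.Cruxes.LatticeGapOnTrajectory.TrajectoryGapScaling

end
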